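import Literature.AlgebraicGeometry.Resolution.GiraudLogJacobianIdeal
import HarnessLib

/-!
# Route `RadicialJung`, crux `CleanModels` (stmt-15917): finiteness of the Giraud-singular set from LOCAL
# SPREADING + compactness — brick B3 / FILE 2a (the topological assembly) of T2-ARCHITECTURE

Support file (OURS) for PROGRAMME-clean-dim2 / T2 (`HOME/L/res-L0-w81-pv-2/g5/T2-ARCHITECTURE.md`, brick
**B3** «{ξ : IsGiraudSingularPoint X f ξ} is finite when (*) holds on E(f) — local spreading … + compactness»;
seat res-L1-s42-pv-2 g7, res-plan-2 IDLE POOL DEAL #50 (2)), line `via-clean-models` of the crux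
`DescentPerfectToAll` (stmt-0549).  Nothing here is a statement of Hironaka's manuscript.  AI-written; AI
review weaker than expert review.

B3 splits as LOCAL SPREADING (every point `x` has an open neighbourhood on which the only possible
Giraud-singular point is `x` itself — the commutative-algebra heart: a chart with global dual derivations on
which `J(A, f; log) = g · D_A` with `V(D_A) ⊆ {x}`, FILE 1 `…GiraudCoprincipalPart` gives the point-level half
`V(D) = {𝔪}`) plus the ASSEMBLY proved here: on a compact (quasi-compact) scheme local spreading gives
finiteness (`finite_setOf_isGiraudSingularPoint_of_spread`), and it suffices to spread at the points of
`E(f)` once `E(f)` is closed (`…_of_spread_on_derivCriticalSet`, B2's closedness as a hypothesis), because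
Giraud-singular points lie in `E(f)` by definition.  The purely topological lemma
`Set.finite_of_forall_exists_isOpen_inter_subset_singleton` is stated for any compact space.
-/

set_option linter.dupNamespace false -- mandated namespace of this single-conjunct summit

open Literature.AlgebraicGeometry.Resolution AlgebraicGeometry

namespace Summit.ResolutionOfSingularities.ResolutionOfSingularities.Theorems.RadicialJung.CleanModels

universe u v

/-! ## The topological lemma -/

/-- **Local spreading on a compact space gives finiteness**: if every point `x` has an open neighbourhood `U`
with `S ∩ U ⊆ {x}`, then `S` is finite (it is contained in the centres of a finite subcover). -/
theorem _root_.Set.finite_of_forall_exists_isOpen_inter_subset_singleton {α : Type v} [TopologicalSpace α]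
    [CompactSpace α] {S : Set α} (h : ∀ x : α, ∃ U : Set α, IsOpen U ∧ x ∈ U ∧ S ∩ U ⊆ {x}) : S.Finite := by
  choose U hUo hxU hSU using h
  obtain ⟨t, ht⟩ := isCompact_univ.elim_finite_subcover U hUo fun x _ => Set.mem_iUnion.mpr ⟨x, hxU x⟩
  refine t.finite_toSet.subset fun s hs => ?_
  obtain ⟨i, hi, hsi⟩ : ∃ i ∈ t, s ∈ U i := by simpa [Set.mem_iUnion] using ht (Set.mem_univ s)
  have hs_eq : s = i := Set.mem_singleton_iff.mp (hSU i ⟨hs, hsi⟩)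
  rw [hs_eq]
  exact hi

/-! ## The assembly for Giraud-singular points -/

/-- **B3 assembly — finiteness from local spreading.**  On a compact scheme, if every point `x` has an open
neighbourhood on which every Giraud-singular point of `f` equals `x`, the Giraud-singular set of `f` is finite. -/
theorem finite_setOf_isGiraudSingularPoint_of_spread (X : Scheme.{u}) [CompactSpace X] (f : Γ(X, ⊤))
    (h : ∀ x : X, ∃ U : Set X, IsOpen U ∧ x ∈ U ∧ ∀ ξ ∈ U, IsGiraudSingularPoint X f ξ → ξ = x) :
    {ξ : X | IsGiraudSingularPoint X f ξ}.Finite := by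
  refine Set.finite_of_forall_exists_isOpen_inter_subset_singleton fun x => ?_
  obtain ⟨U, hUo, hxU, hU⟩ := h x
  exact ⟨U, hUo, hxU, fun ξ ⟨hξ, hξU⟩ => Set.mem_singleton_iff.mpr (hU ξ hξU hξ)⟩

/-- Giraud-singular points lie in `E(f)` (by definition). -/
theorem mem_derivCriticalSet_of_isGiraudSingularPoint {X : Scheme.{u}} {f : Γ(X, ⊤)} {ξ : X}
    (h : IsGiraudSingularPoint X f ξ) : ξ ∈ derivCriticalSet X f :=
  h.2.1

/-- **B3 assembly, spreading only along `E(f)`.**  If `E(f)` is closed (brick B2) and every point of `E(f)` has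
an open neighbourhood on which every Giraud-singular point equals it, the Giraud-singular set is finite — off
`E(f)` the complement of `E(f)` spreads trivially. -/
theorem finite_setOf_isGiraudSingularPoint_of_spread_on_derivCriticalSet (X : Scheme.{u}) [CompactSpace X]
    (f : Γ(X, ⊤)) (hE : IsClosed (derivCriticalSet X f))
    (h : ∀ x ∈ derivCriticalSet X f,
      ∃ U : Set X, IsOpen U ∧ x ∈ U ∧ ∀ ξ ∈ U, IsGiraudSingularPoint X f ξ → ξ = x) :
    {ξ : X | IsGiraudSingularPoint X f ξ}.Finite := by
  refine finite_setOf_isGiraudSingularPoint_of_spread X f fun x => ?_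
  by_cases hx : x ∈ derivCriticalSet X f
  · exact h x hx
  · refine ⟨(derivCriticalSet X f)ᶜ, hE.isOpen_compl, hx, fun ξ hξU hξ => ?_⟩
    exact absurd (mem_derivCriticalSet_of_isGiraudSingularPoint hξ) hξU

/-- **Pointwise reformulation of local spreading** (the form FILE 2b proves on a chart): it suffices that every
point `x` has an open neighbourhood `U` such that every CLOSED point `ξ ≠ x` of `U ∩ E(f)` at which `E(f)` has
strict normal crossings has colength `c(X, f, ξ) = 0`. -/
theorem finite_setOf_isGiraudSingularPoint_of_colength_spread (X : Scheme.{u}) [CompactSpace X] (f : Γ(X, ⊤))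
    (h : ∀ x : X, ∃ U : Set X, IsOpen U ∧ x ∈ U ∧ ∀ ξ ∈ U, ξ ≠ x → IsClosed ({ξ} : Set X) →
      ξ ∈ derivCriticalSet X f → IsStrictNormalCrossingsAt X (derivCriticalSet X f) ξ →
      giraudColength (X.presheaf.stalk ξ) (X.presheaf.germ ⊤ ξ trivial f) = 0) :
    {ξ : X | IsGiraudSingularPoint X f ξ}.Finite := by
  refine finite_setOf_isGiraudSingularPoint_of_spread X f fun x => ?_
  obtain ⟨U, hUo, hxU, hU⟩ := h x
  refine ⟨U, hUo, hxU, fun ξ hξU hξ => ?_⟩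
  by_contra hne
  exact hξ.2.2.2 (hU ξ hξU hne hξ.1 hξ.2.1 hξ.2.2.1)

end Summit.ResolutionOfSingularities.ResolutionOfSingularities.Theorems.RadicialJung.CleanModels
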